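import Summits.Ventures.Crystal3D.Theorems.StickyWulffConstantCoaxialWallLawPayerTransCellPlaneExport
import Summits.Ventures.Crystal3D.Theorems.StickyWulffConstantCoaxialWallLawPayerTransCellGenericTop
import HarnessLib

/-!
# End accounting, census-free, multi-source VII″: the TOP plate's pooled end pairs of a plane-coset translation pair,
# pulled back with their reading witnesses

HONEST FRAMING. Part of the venture `Summits/Ventures/Crystal3D` (cell `crystal3d-full`), helper for the crux
`CoaxialWallLaw` (stmt-Ventures-19481) of `route-Ventures-StickyWulffConstant`, REGISTERED line `WallLedgerF`
(planner cf-p1), open stub `stub_coaxialTwoSlabAdhesion` (general fillings).  Rung credit only; F-C1 not moved.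
Memo HOME/wall-19481-p2/F-NEXT-SPEC.md §S1-STATUS (19481-p2 g4), planner (xxv) two-plate charging.
`wordNet_trans_endPairs_plane_multi` (`…PayerTransCellPlaneExport`) applied to the MIRROR IMAGE of the cell under
`M : (x, y, z) ↦ (x, y, h − z)` (frame `S ∘ G₀`, offsets `M s₂`, `M s₁`, plates swapped, roots `−r` for `r ∈ RT`, the
same skew partners — the offset's pairing with a partner only changes sign), with the pairs pulled back through `M`
into `X × X`.  The point of this file (vs. the generic `…PayerTransCellGenericTop`, which only pulls back an invariant):
the top plate's word system is `F′ κ = S ∘ F κ`, so the READING WITNESSES pull back VERBATIM into the bottom word system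
`F` — same chain `κ`, mirror normal `S m`, direction `d = F κ ((−1)^{|κ|} (−r))` — which is exactly LEMMA X's input
for bottom/top pairs of DIFFERENT roots; pairs of the SAME root carry the half-integer invariant with respect to `s₂`:
`⟪G₀⁻¹(b − s₂), sk r⟫ ∈ ½ℤ` (`wordNet_trans_endPairs_plane_top`).

WHAT THIS IS NOT: not the two-plate cell (next file); F-C1 not moved.
-/

noncomputable section

namespace Summit.Ventures.Crystal3D.Theorems

open Summit.Ventures.Crystal3D Finset
open Literature.MathematicalPhysics.StatisticalMechanics (fccStacking)
open scoped InnerProductSpace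

open scoped Classical in
/-- **The top plate's pooled end pairs of a plane-coset translation pair, pulled back with witnesses.**  See the
module docstring. -/
theorem wordNet_trans_endPairs_plane_top
    {δ : ℝ} (hg : KissingGap δ) (hc : KissingClassification δ)
    (G₀ : EuclideanSpace ℝ (Fin 3) ≃ₗᵢ[ℝ] EuclideanSpace ℝ (Fin 3))
    {F : List (EuclideanSpace ℝ (Fin 3)) → (EuclideanSpace ℝ (Fin 3) ≃ₗᵢ[ℝ] EuclideanSpace ℝ (Fin 3))}
    (hF0 : F [] = G₀) (hFc : ∀ μ κ, F (μ :: κ) = ((ℝ ∙ μ)ᗮ.reflection).trans (F κ))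
    (RT : Finset (EuclideanSpace ℝ (Fin 3))) (hRT : ∀ r ∈ RT, r ∈ fccSlots ∧ 0 < (G₀ r) 2)
    (sk : EuclideanSpace ℝ (Fin 3) → EuclideanSpace ℝ (Fin 3))
    (s₁ s₂ : EuclideanSpace ℝ (Fin 3))
    (hsk : ∀ r ∈ RT, sk r ∈ fccSlots ∧ ⟪r, sk r⟫_ℝ = 0 ∧ ∀ z : ℤ, ⟪G₀.symm (s₂ - s₁), sk r⟫_ℝ ≠ (z : ℝ) / 2)
    (X P₁ P₂ : Finset (EuclideanSpace ℝ (Fin 3))) (R₀ h ρ : ℝ)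
    (hR₀ : 10 ≤ R₀) (hh : 0 ≤ h) (hρ : R₀ ≤ ρ)
    (hX : ∀ p ∈ X, ∀ q ∈ X, p ≠ q → 1 ≤ dist p q)
    (hcell : ∀ p ∈ X, -(2 * R₀) ≤ p 2 ∧ p 2 ≤ h + 2 * R₀ ∧ p 0 ^ 2 + p 1 ^ 2 ≤ ρ ^ 2)
    (hP₁X : P₁ ⊆ X) (hP₂X : P₂ ⊆ X)
    (hP₁ : ∀ p, p ∈ P₁ ↔ (p ∈ (fun q => G₀ q + s₁) '' fccStacking 1 (Real.sqrt (2 / 3)) ∧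
      -(2 * R₀) ≤ p 2 ∧ p 2 ≤ -R₀ ∧ p 0 ^ 2 + p 1 ^ 2 ≤ ρ ^ 2))
    (hP₂ : ∀ p, p ∈ P₂ ↔ (p ∈ (fun q => G₀ q + s₂) '' fccStacking 1 (Real.sqrt (2 / 3)) ∧
      h + R₀ ≤ p 2 ∧ p 2 ≤ h + 2 * R₀ ∧ p 0 ^ 2 + p 1 ^ 2 ≤ ρ ^ 2)) :
    ∃ T : Finset (EuclideanSpace ℝ (Fin 3) × EuclideanSpace ℝ (Fin 3)),
      Real.sqrt 2 * (∑ r ∈ RT, (G₀ r) 2) * Real.pi * ρ ^ 2 -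
          12 * (12 * Real.sqrt 2 * Real.pi + 36 * R₀ + 55440) * ρ ≤ (T.card : ℝ) ∧
      (∀ bq ∈ T, bq.1 ∈ X ∧ bq.2 ∈ X ∧ dist bq.1 bq.2 = 1 ∧ -R₀ - 1 ≤ bq.1 2 ∧ bq.1 2 ≤ h + R₀ + 1) ∧
      (∀ bq ∈ T, (X.filter fun q => dist bq.1 q = 1).card ≤ 11 ∨
        ∃ z₁ ∈ X, ∃ z₂ ∈ X, z₁ ≠ z₂ ∧ dist bq.1 z₁ = 1 ∧ dist bq.1 z₂ = 1 ∧
          (X.filter fun q => dist z₁ q = 1).card ≤ 11 ∧ (X.filter fun q => dist z₂ q = 1).card ≤ 11) ∧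
      (∀ bq ∈ T, ∃ r ∈ RT, (∃ z : ℤ, ⟪G₀.symm (bq.1 - s₂), sk r⟫_ℝ = (z : ℝ) / 2) ∧
        ∃ (κ : List (EuclideanSpace ℝ (Fin 3))) (d : EuclideanSpace ℝ (Fin 3)),
        (∀ μ ∈ κ, ‖μ‖ = 1 ∧
          ∀ w ∈ fccSlots, ⟪w, μ⟫_ℝ = 0 ∨ ⟪w, μ⟫_ℝ = Real.sqrt (2 / 3) ∨ ⟪w, μ⟫_ℝ = -Real.sqrt (2 / 3)) ∧
        List.IsChain (fun μ μ' => ⟪μ, μ'⟫_ℝ = 1 / 3 ∨ ⟪μ, μ'⟫_ℝ = -1 / 3) κ ∧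
        d = F κ (((-1 : ℝ) ^ κ.length) • (-r)) ∧
        (((∀ w ∈ fccSlots, bq.2 + F κ w ∈ X) ∧ bq.1 = bq.2 + d) ∨
          ∃ m : EuclideanSpace ℝ (Fin 3), ‖m‖ = 1 ∧
            (∀ w ∈ fccSlots, ⟪F κ w, m⟫_ℝ = 0 ∨ ⟪F κ w, m⟫_ℝ = Real.sqrt (2 / 3) ∨ ⟪F κ w, m⟫_ℝ = -Real.sqrt (2 / 3)) ∧
            (∀ w ∈ fccSlots, ⟪F κ w, m⟫_ℝ ≤ 0 → bq.2 + F κ w ∈ X) ∧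
            (∀ w ∈ fccSlots, ⟪F κ w, m⟫_ℝ < 0 → bq.2 + (F κ w - (2 * ⟪F κ w, m⟫_ℝ) • m) ∈ X) ∧
            (∀ w ∈ fccSlots, 0 < ⟪F κ w, m⟫_ℝ → bq.2 + F κ w ∉ X) ∧
            ((⟪d, m⟫_ℝ = Real.sqrt (2 / 3) ∧ bq.1 = bq.2 - (d - (2 * ⟪d, m⟫_ℝ) • m)) ∨
              (⟪d, m⟫_ℝ = 0 ∧ bq.1 = bq.2 + d)))) := by
  -- the vertical mirror `S` and the cell mirror `M`
  set S : EuclideanSpace ℝ (Fin 3) ≃ₗᵢ[ℝ] EuclideanSpace ℝ (Fin 3) :=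
    ((ℝ ∙ EuclideanSpace.single (2 : Fin 3) (1 : ℝ)).reflection).trans (LinearIsometryEquiv.neg ℝ) with hS
  have hS_apply : ∀ p, S p = -((ℝ ∙ EuclideanSpace.single (2 : Fin 3) (1 : ℝ)).reflection p) := fun p => rfl
  have hS0 : ∀ p : EuclideanSpace ℝ (Fin 3), S p 0 = p 0 := by
    intro p; rw [hS_apply, PiLp.neg_apply, (halfTurn_coord p).1, neg_neg]
  have hS1 : ∀ p : EuclideanSpace ℝ (Fin 3), S p 1 = p 1 := by
    intro p; rw [hS_apply, PiLp.neg_apply, (halfTurn_coord p).2.1, neg_neg]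
  have hS2 : ∀ p : EuclideanSpace ℝ (Fin 3), S p 2 = -p 2 := by
    intro p; rw [hS_apply, PiLp.neg_apply, (halfTurn_coord p).2.2]
  have hSS : ∀ p, S (S p) = p := by
    intro p
    ext l
    fin_cases l
    · simp only [Fin.zero_eta, Fin.isValue]; rw [hS0, hS0]
    · simp only [Fin.mk_one, Fin.isValue]; rw [hS1, hS1]
    · simp only [Fin.reduceFinMk, Fin.isValue]; rw [hS2, hS2, neg_neg]
  clear_value S
  have hSin : ∀ x y : EuclideanSpace ℝ (Fin 3), ⟪S x, y⟫_ℝ = ⟪x, S y⟫_ℝ := by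
    intro x y; rw [← S.inner_map_map x (S y), hSS]
  set cM : EuclideanSpace ℝ (Fin 3) := h • EuclideanSpace.single (2 : Fin 3) (1 : ℝ) with hcM
  have hc0 : cM 0 = 0 := by simp [hcM]
  have hc1 : cM 1 = 0 := by simp [hcM]
  have hc2 : cM 2 = h := by simp [hcM]
  let M : EuclideanSpace ℝ (Fin 3) → EuclideanSpace ℝ (Fin 3) := fun p => S p + cM
  have hM0 : ∀ p, M p 0 = p 0 := by intro p; simp only [M, PiLp.add_apply, hS0, hc0, add_zero]
  have hM1 : ∀ p, M p 1 = p 1 := by intro p; simp only [M, PiLp.add_apply, hS1, hc1, add_zero]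
  have hM2 : ∀ p, M p 2 = h - p 2 := by
    intro p; simp only [M, PiLp.add_apply, hS2, hc2]; ring
  have hSc : S cM = -cM := by
    ext l; fin_cases l
    · simp only [Fin.zero_eta, Fin.isValue]; rw [hS0, PiLp.neg_apply, hc0, neg_zero]
    · simp only [Fin.mk_one, Fin.isValue]; rw [hS1, PiLp.neg_apply, hc1, neg_zero]
    · simp only [Fin.reduceFinMk, Fin.isValue]; rw [hS2, PiLp.neg_apply]
  have hMM : ∀ p, M (M p) = p := by
    intro p
    simp only [M, map_add, hSS, hSc]; abel
  have hMinj : Function.Injective M := fun p q hpq => by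
    have := congrArg M hpq; rwa [hMM, hMM] at this
  have hMdist : ∀ p q, dist (M p) (M q) = dist p q := by
    intro p q; simp only [M, dist_add_right, LinearIsometryEquiv.dist_map]
  have hMadd : ∀ p w, M (p + w) = M p + S w := by
    intro p w; simp only [M, map_add]; abel
  have hMsub' : ∀ p w, M (p - w) = M p - S w := by
    intro p w; simp only [M, map_sub]; abel
  have hMsubM : ∀ p q, M p - M q = S (p - q) := by
    intro p q; simp only [M, map_sub]; abel
  have hMrad : ∀ p, M p 0 ^ 2 + M p 1 ^ 2 = p 0 ^ 2 + p 1 ^ 2 := by intro p; rw [hM0, hM1]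
  -- the mirrored data
  set X' := X.image M with hX'
  have hmemIm : ∀ (Q : Finset (EuclideanSpace ℝ (Fin 3))) p, p ∈ Q.image M ↔ M p ∈ Q := by
    intro Q p
    rw [mem_image]
    constructor
    · rintro ⟨x, hx, hxp⟩; rw [← hxp, hMM]; exact hx
    · intro hp; exact ⟨M p, hp, hMM p⟩
  have hmemX' : ∀ p, p ∈ X' ↔ M p ∈ X := hmemIm X
  have hX'sep : ∀ p ∈ X', ∀ q ∈ X', p ≠ q → 1 ≤ dist p q := by
    intro p hp q hq hpq
    rw [← hMdist]
    exact hX _ ((hmemX' p).1 hp) _ ((hmemX' q).1 hq) (fun h' => hpq (hMinj h'))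
  have hcell' : ∀ p ∈ X', -(2 * R₀) ≤ p 2 ∧ p 2 ≤ h + 2 * R₀ ∧ p 0 ^ 2 + p 1 ^ 2 ≤ ρ ^ 2 := by
    intro p hp
    obtain ⟨h1, h2, h3⟩ := hcell _ ((hmemX' p).1 hp)
    rw [hM2] at h1 h2; rw [hMrad] at h3
    exact ⟨by linarith, by linarith, h3⟩
  set G' : EuclideanSpace ℝ (Fin 3) ≃ₗᵢ[ℝ] EuclideanSpace ℝ (Fin 3) := G₀.trans S with hG'
  have hG'ap : ∀ x, G' x = S (G₀ x) := fun x => rfl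
  clear_value G'
  have hG'symm : ∀ x, G'.symm x = G₀.symm (S x) := by
    intro x
    apply G'.injective
    rw [LinearIsometryEquiv.apply_symm_apply, hG'ap, LinearIsometryEquiv.apply_symm_apply, hSS]
  have hlat : ∀ (s p : EuclideanSpace ℝ (Fin 3)),
      M p ∈ (fun q => G₀ q + s) '' fccStacking 1 (Real.sqrt (2 / 3)) ↔
        p ∈ (fun q => G' q + M s) '' fccStacking 1 (Real.sqrt (2 / 3)) := by
    intro s p
    simp only [Set.mem_image, hG'ap]
    constructor
    · rintro ⟨q, hq, hqp⟩
      refine ⟨q, hq, ?_⟩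
      have hqp' : s + G₀ q = M p := by rw [add_comm]; exact hqp
      have := congrArg M hqp'
      rw [hMM, hMadd] at this
      rw [add_comm]; exact this
    · rintro ⟨q, hq, hqp⟩
      refine ⟨q, hq, ?_⟩
      rw [← hqp, show S (G₀ q) + M s = M (s + G₀ q) by rw [hMadd, add_comm], hMM, add_comm]
  have hP₁' : ∀ p, p ∈ P₂.image M ↔ (p ∈ (fun q => G' q + M s₂) '' fccStacking 1 (Real.sqrt (2 / 3)) ∧
      -(2 * R₀) ≤ p 2 ∧ p 2 ≤ -R₀ ∧ p 0 ^ 2 + p 1 ^ 2 ≤ ρ ^ 2) := by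
    intro p
    rw [hmemIm, hP₂, hM2, hMrad, hlat]
    constructor
    · rintro ⟨h1, h2, h3, h4⟩; exact ⟨h1, by linarith, by linarith, h4⟩
    · rintro ⟨h1, h2, h3, h4⟩; exact ⟨h1, by linarith, by linarith, h4⟩
  have hP₂' : ∀ p, p ∈ P₁.image M ↔ (p ∈ (fun q => G' q + M s₁) '' fccStacking 1 (Real.sqrt (2 / 3)) ∧
      h + R₀ ≤ p 2 ∧ p 2 ≤ h + 2 * R₀ ∧ p 0 ^ 2 + p 1 ^ 2 ≤ ρ ^ 2) := by
    intro p
    rw [hmemIm, hP₁, hM2, hMrad, hlat]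
    constructor
    · rintro ⟨h1, h2, h3, h4⟩; exact ⟨h1, by linarith, by linarith, h4⟩
    · rintro ⟨h1, h2, h3, h4⟩; exact ⟨h1, by linarith, by linarith, h4⟩
  have hP₁'X : P₂.image M ⊆ X' := image_subset_image hP₂X
  have hP₂'X : P₁.image M ⊆ X' := image_subset_image hP₁X
  -- the top plate's word system `F′ κ = S ∘ F κ`
  set F' : List (EuclideanSpace ℝ (Fin 3)) → (EuclideanSpace ℝ (Fin 3) ≃ₗᵢ[ℝ] EuclideanSpace ℝ (Fin 3)) :=
    fun κ => (F κ).trans S with hF'def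
  have hF'ap : ∀ κ x, F' κ x = S (F κ x) := fun _ _ => rfl
  have hF'0 : F' [] = G' := by
    apply LinearIsometryEquiv.ext; intro x; rw [hF'ap, hG'ap, hF0]
  have hF'c : ∀ μ κ, F' (μ :: κ) = ((ℝ ∙ μ)ᗮ.reflection).trans (F' κ) := by
    intro μ κ
    apply LinearIsometryEquiv.ext; intro x
    rw [hF'ap, hFc]; rfl
  clear_value F'
  -- the mirrored roots `−r` and their partners
  set RT' := RT.image (fun r : EuclideanSpace ℝ (Fin 3) => -r) with hRT'def
  have hRT' : ∀ r' ∈ RT', r' ∈ fccSlots ∧ 0 < (G' r') 2 := by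
    intro r' hr'
    obtain ⟨r, hr, rfl⟩ := mem_image.1 hr'
    refine ⟨neg_mem_fccSlots (hRT r hr).1, ?_⟩
    rw [hG'ap, hS2, map_neg, PiLp.neg_apply, neg_neg]; exact (hRT r hr).2
  set sk' : EuclideanSpace ℝ (Fin 3) → EuclideanSpace ℝ (Fin 3) := fun r' => sk (-r') with hsk'def
  have hsk'ap : ∀ r', sk' r' = sk (-r') := fun _ => rfl
  clear_value sk'
  have hsk' : ∀ r' ∈ RT', sk' r' ∈ fccSlots ∧ ⟪r', sk' r'⟫_ℝ = 0 ∧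
      ∀ z : ℤ, ⟪G'.symm (M s₁ - M s₂), sk' r'⟫_ℝ ≠ (z : ℝ) / 2 := by
    intro r' hr'
    obtain ⟨r, hr, rfl⟩ := mem_image.1 hr'
    obtain ⟨h1, h2, h3⟩ := hsk r hr
    rw [hsk'ap, neg_neg]
    refine ⟨h1, by rw [inner_neg_left, h2, neg_zero], ?_⟩
    intro z hz
    rw [hMsubM, hG'symm, hSS, show s₁ - s₂ = -(s₂ - s₁) by abel, map_neg, inner_neg_left] at hz
    exact h3 (-z) (by push_cast; linarith)
  -- the mirrored cell's export
  obtain ⟨T', hflux', hTpair', hTpay', hTwit'⟩ :=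
    wordNet_trans_endPairs_plane_multi hg hc G' hF'0 hF'c RT' hRT' sk' (M s₂) (M s₁) hsk' X' (P₂.image M)
      (P₁.image M) R₀ h ρ hR₀ hh hρ hX'sep hcell' hP₁'X hP₂'X hP₁' hP₂'
  -- the rising flux of the mirrored roots is the rising flux of `RT`
  have hsum : ∑ r' ∈ RT', (G' r') 2 = ∑ r ∈ RT, (G₀ r) 2 := by
    rw [hRT'def, sum_image (fun a _ b _ hab => neg_injective hab)]
    refine sum_congr rfl fun r _ => ?_
    rw [hG'ap, hS2, map_neg, PiLp.neg_apply, neg_neg]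
  rw [hsum] at hflux'
  -- pull the pairs back
  set T : Finset (EuclideanSpace ℝ (Fin 3) × EuclideanSpace ℝ (Fin 3)) := T'.image (fun bq => (M bq.1, M bq.2)) with hT
  have hPinj : Function.Injective (fun bq : EuclideanSpace ℝ (Fin 3) × EuclideanSpace ℝ (Fin 3) => (M bq.1, M bq.2)) := by
    intro a b hab
    simp only [Prod.mk.injEq] at hab
    exact Prod.ext (hMinj hab.1) (hMinj hab.2)
  have hTcard : T.card = T'.card := card_image_of_injective _ hPinj
  have hdeg : ∀ b, (X'.filter fun q => dist b q = 1).card = (X.filter fun q => dist (M b) q = 1).card := by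
    intro b
    have : (X.filter fun q => dist (M b) q = 1) = (X'.filter fun q => dist b q = 1).image M := by
      ext q
      rw [mem_filter, mem_image]
      constructor
      · rintro ⟨hq, hd⟩
        refine ⟨M q, mem_filter.2 ⟨(hmemX' _).2 (by rw [hMM]; exact hq), ?_⟩, hMM q⟩
        rw [← hMdist, hMM]; exact hd
      · rintro ⟨q', hq', rfl⟩
        obtain ⟨hq'X, hd⟩ := mem_filter.1 hq'
        exact ⟨(hmemX' q').1 hq'X, by rw [hMdist]; exact hd⟩
    rw [this, card_image_of_injective _ hMinj]
  refine ⟨T, by rw [hTcard]; exact hflux', ?_, ?_, ?_⟩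
  · intro bq hbq
    obtain ⟨bq', hbq', rfl⟩ := mem_image.1 hbq
    obtain ⟨h1, h2, h3, h4, h5⟩ := hTpair' bq' hbq'
    refine ⟨(hmemX' _).1 h1, (hmemX' _).1 h2, by show dist (M bq'.1) (M bq'.2) = 1; rw [hMdist]; exact h3, ?_, ?_⟩
    · show -R₀ - 1 ≤ M bq'.1 2; rw [hM2]; linarith
    · show M bq'.1 2 ≤ h + R₀ + 1; rw [hM2]; linarith
  · intro bq hbq
    obtain ⟨bq', hbq', rfl⟩ := mem_image.1 hbq
    rcases hTpay' bq' hbq' with h11 | ⟨z₁, hz₁, z₂, hz₂, hne, hd₁, hd₂, hc₁, hc₂⟩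
    · left; show (X.filter fun q => dist (M bq'.1) q = 1).card ≤ 11; rw [← hdeg]; exact h11
    · right
      refine ⟨M z₁, (hmemX' _).1 hz₁, M z₂, (hmemX' _).1 hz₂, fun h' => hne (hMinj h'), ?_, ?_, ?_, ?_⟩
      · show dist (M bq'.1) (M z₁) = 1; rw [hMdist]; exact hd₁
      · show dist (M bq'.1) (M z₂) = 1; rw [hMdist]; exact hd₂
      · rw [← hdeg]; exact hc₁
      · rw [← hdeg]; exact hc₂
  · intro bq hbq
    obtain ⟨bq', hbq', rfl⟩ := mem_image.1 hbq
    obtain ⟨r', hr', ⟨z, hz⟩, κ, d', hlet, hch, hd', hpat'⟩ := hTwit' bq' hbq'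
    obtain ⟨r, hr, rfl⟩ := mem_image.1 hr'
    rw [hsk'ap, neg_neg] at hz
    refine ⟨r, hr, ⟨z, ?_⟩, κ, S d', hlet, hch, ?_, ?_⟩
    · show ⟪G₀.symm (M bq'.1 - s₂), sk r⟫_ℝ = (z : ℝ) / 2
      have e : M bq'.1 - s₂ = S (bq'.1 - M s₂) := by rw [← hMsubM, hMM]
      rw [e, ← hG'symm]; exact hz
    · rw [hd', hF'ap, hSS]
    · -- the reading witness pulls back verbatim (`S ∘ F′ κ = F κ`, mirror normal `S m`)
      have hMF : ∀ w, M (bq'.2 + F' κ w) = M bq'.2 + F κ w := by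
        intro w; rw [hMadd, hF'ap, hSS]
      rcases hpat' with ⟨hfull, htar⟩ | ⟨m, hm1, hmenu, hle, hlt, hpos, htar⟩
      · left
        refine ⟨fun w hw => ?_, ?_⟩
        · show M bq'.2 + F κ w ∈ X
          rw [← hMF]; exact (hmemX' _).1 (hfull w hw)
        · show M bq'.1 = M bq'.2 + S d'
          rw [htar, hMadd]
      · right
        have hin : ∀ w, ⟪F' κ w, m⟫_ℝ = ⟪F κ w, S m⟫_ℝ := by intro w; rw [hF'ap, hSin]
        have hdin : ⟪d', m⟫_ℝ = ⟪S d', S m⟫_ℝ := by rw [S.inner_map_map]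
        refine ⟨S m, by rw [LinearIsometryEquiv.norm_map, hm1], fun w hw => ?_, fun w hw hw0 => ?_,
          fun w hw hw0 => ?_, fun w hw hw0 => ?_, ?_⟩
        · rw [← hin]; exact hmenu w hw
        · show M bq'.2 + F κ w ∈ X
          rw [← hMF]; exact (hmemX' _).1 (hle w hw (by rw [hin]; exact hw0))
        · show M bq'.2 + (F κ w - (2 * ⟪F κ w, S m⟫_ℝ) • S m) ∈ X
          have h1 := (hmemX' _).1 (hlt w hw (by rw [hin]; exact hw0))
          rw [hin, hMadd, map_sub, LinearIsometryEquiv.map_smul, hF'ap, hSS] at h1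
          exact h1
        · show M bq'.2 + F κ w ∉ X
          intro hmem
          apply hpos w hw (by rw [hin]; exact hw0)
          rw [hmemX', hMF]; exact hmem
        · rcases htar with ⟨hdm, htar⟩ | ⟨hdm, htar⟩
          · left
            refine ⟨by rw [← hdin]; exact hdm, ?_⟩
            show M bq'.1 = M bq'.2 - (S d' - (2 * ⟪S d', S m⟫_ℝ) • S m)
            rw [htar, hMsub', map_sub, LinearIsometryEquiv.map_smul, ← hdin]
          · right
            refine ⟨by rw [← hdin]; exact hdm, ?_⟩
            show M bq'.1 = M bq'.2 + S d'
            rw [htar, hMadd]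

end Summit.Ventures.Crystal3D.Theorems

end
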